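import Summits.BirchSwinnertonDyer.BirchSwinnertonDyer.Theorems.SignedBaseChangeAnticyclotomicEisensteinDivisibilityAdmdefSelmerBookkeeping
import Summits.BirchSwinnertonDyer.BirchSwinnertonDyer.Theorems.SignedBaseChangeAnticyclotomicEisensteinDivisibilityAdmdefBipartiteNVLevelOne
import HarnessLib

/-!
# Line `admdef` (crux `AnticyclotomicEisensteinDivisibility`, stmt-BirchSwinnertonDyer-20727), rigidity road (M4): HOWARD'S MERGE
# INDUCTION at the bottom layer — a unit `λ` at ANY definite vertex forces the CORE ROOT `κ_1(1)_0 ≠ 0` of a rank-one bottom Selmer group,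
# MODULO Howard's vanishing lemma «unit `λ_1(n)(0)` ⟹ `Sel^ε_n(K_0, E[p]) = 0`» (hypothesis)

LEAD seat bsd-line-sbc-p1 (gen 28), `--supports stmt-BirchSwinnertonDyer-20727` (helper; OFF the v23 composition path; item (M4) «merge induction» of
the rigidity road map `Lines/admdef-lead-g25.md` §4, with (M1)'s duality content isolated as ONE hypothesis).  For a signed bipartite system `B`
(CHKLL25 Thm. 7.4 as typed, `IsSignedBipartiteSystem`, sign `ε`, level `N = N_E`) over an imaginary quadratic `K` with anticyclotomic `κ`, write
`Sel_n = Sel^ε_n(K_0, E[p])` for CHKLL25's `signedOrdSelmerTorsion (E/K) p κ ε n 0 1` (signed at `p`, ordinary at the primes of `n`, unramified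
elsewhere; bottom layer, `j = 1`).  THE THEOREM (`kappa_one_layer_zero_ne_zero_of_isUnit_lam_of_vanishing`):

  (HV) for every `n ∈ 𝒩_1^def` with `λ_1(n)(0) ∈ ℤ_pˣ`, `Sel_n = 0`   [HYPOTHESIS — Howard's vanishing lemma, [Howard2006] Lem. 2.3.4 ∕
       [BertoliniDarmon2005] proof of Thm. 4.1 step 3: global duality + the first reciprocity law; NOT proved here]
  (RK1) `Sel_1 = 𝔽_p · s` with `s ≠ 0`   [the bottom Selmer group at the root is a LINE]
  (NV)  `λ_1(n₀)(0) ∈ ℤ_pˣ` for SOME `n₀ ∈ 𝒩_1^def`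
  ⟹ `κ_1(1)_0 ≠ 0` (and `z_{0,1} ≠ 0` for the limit base class; `B.HasUnitLambda N` suffices for (NV), by g16's `hasUnitLambda_iff_level_one`).

This is the `(c)`-direction of Howard's rigidity ([Howard2006] Thm. 3.2.3 (c) ∕ BCK21 Prop. 7.4 ∕ CHKLL25 Thm. 7.5 «Moreover») at the ROOT modulo
`𝔪 = (p, T)`, reduced to its single analytic input (HV).  PROOF — the merge induction, by strong induction on the number `r` of prime factors of
`n₀` (odd), using ONLY kernel steps already landed on this line and NO Čebotarev prime:
* (HV) gives `Sel_{n₀} = 0`, so `s ∉ Sel_{n₀}`: some prime `qᵢ ∣ n₀` is SEEN by `s` (`res_{⟨φᵢ⟩} s ≠ 0` for a Frobenius `φᵢ ∈ D_{𝔓ᵢ}`,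
  `𝔓ᵢ ∣ qᵢ`) — Selmer bookkeeping `mem_signedOrdSelmerTorsion_of_dvd_of_forall_ordinaryAt` (transfer UP along `1 ∣ n₀` fails only at a seen prime);
* `r = 1`: `n₀ = qᵢ`, and the root step `…AdmdefRootVisibleOfUnitLambda.kappa_one_layer_zero_ne_zero_of_isUnit_lam` with witness `u = res s ≠ 0`;
* `r ≥ 3`: pick a prime `qⱼ ∣ n₀`, `qⱼ ≠ qᵢ`, `M = n₀/qⱼ ∈ 𝒩_1^ind`.  DESCENT (witness-free, `…AdmdefUnrLineNonzero`): `κ_1(M)_0 ≠ 0`.  Either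
  (A) `κ_1(M)_0` is RAMIFIED at some `q' ∣ M`: then `ordLoc_{𝔓'}(κ_1(M))_0(0) ≠ 0` (`resOfLe_inertia_ne_zero_of_not_mem_unramifiedAt`, `I_{𝔓'} ≤ ker κ`
  by `ZpExtension.inertia_le_kerSubgroup_holds`), so the FIRST law gives `λ_1(M/q')(0) ∈ ℤ_pˣ` (`…AdmdefUnitLambdaOfLoc`) at a definite vertex with
  `r − 2` primes — INDUCTION; or (B) `κ_1(M)_0` is unramified at every prime of `M`: then `κ_1(M)_0 ∈ Sel_1 = 𝔽_p s` (transfer DOWN,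
  `mem_signedOrdSelmerTorsion_of_dvd_of_forall_unramifiedAt`), `κ_1(M)_0 = a·s` with `p ∤ a`, while `κ_1(M)_0 ∈ Sel_M` is ORDINARY at `qᵢ ∣ M`:
  `a · res_{⟨φᵢ⟩} s = 0`, so `res_{⟨φᵢ⟩} s = 0` (Bézout) — contradicting that `qᵢ` is seen by `s`.  Case (B) is where `qⱼ ≠ qᵢ` is used.
So the «two-class Čebotarev» and «fresh primes» of the memo's (M3)/(M4) plan are NOT needed for the root statement.

The arithmetic of square-free products, the Selmer bookkeeping (transfers along `n ∣ n'`, `κ_j(m)_n ∈ Sel`, `D_𝔓 ≤ ker κ`, the ramified-restriction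
lemma, Bézout) are the sibling `…AdmdefSelmerBookkeeping` (same seat); this file is the theorem and its
`IsLimitBaseClass` / `HasUnitLambda` corollaries.

HONEST FRAMING: theorems only (no definition, no named fact, no `sorry`); (HV) and (RK1) are HYPOTHESES (so nothing unconditional about any
Heegner class is claimed); nothing about the crux, the anchors (K1) or BSD is asserted.  What (HV) costs in kernel: the layer-0 local dictionaries
(signed-at-`p` = Kummer needs the `±` control theorem [Kim07 4.18]; unramified/ordinary isotropy) + the tree's Tate reciprocity for totally complex `K`.

References: [cite: Howard2006, Lem. 2.3.3, Lem. 2.3.4, Thm. 3.2.3 (c)] [cite: BurungaleCastellaKim2021, arXiv:1908.09512 Lem. 7.3, Prop. 7.4]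
[cite: CastellaEtAl2025, Thm. 7.4, Thm. 7.5, §7.4 (arXiv:2308.10474v2 pp. 30–33)] [cite: BertoliniDarmon2005, Thm. 4.1 (proof), p. 18]
[cite: WZhang2014, Thm. 9.1 (proof)].
-/

-- D-0017: single-problem summit, the namespace repeats the problem name by design.
set_option linter.dupNamespace false
set_option autoImplicit false

noncomputable section

open scoped Classical NumberField Pointwise

namespace Summit.BirchSwinnertonDyer.BirchSwinnertonDyer.Theorems.SignedBaseChangeAcDivAdmdefHowardMerge

open WeierstrassCurve NumberField IsDedekindDomain Field
open Literature.NumberTheory.EllipticCurves Literature.NumberTheory.GaloisRepresentations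
open Literature.NumberTheory.EllipticCurves.CastellaHsuKunduLeeLiu2025
open Literature.NumberTheory.EllipticCurves.BertoliniDarmon2005
open Summit.BirchSwinnertonDyer.BirchSwinnertonDyer.Theorems.SignedBaseChangeAcDivAdmdefBipartitePropagation
open Summit.BirchSwinnertonDyer.BirchSwinnertonDyer.Theorems.SignedBaseChangeAcDivAdmdefUnitLambdaOfLoc
open Summit.BirchSwinnertonDyer.BirchSwinnertonDyer.Theorems.SignedBaseChangeAcDivAdmdefRootVisibleOfUnitLambda
open Summit.BirchSwinnertonDyer.BirchSwinnertonDyer.Theorems.SignedBaseChangeAcDivAdmdefUnrLineNonzero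

universe u

open Summit.BirchSwinnertonDyer.BirchSwinnertonDyer.Theorems.SignedBaseChangeAcDivAdmdefSelmerBookkeeping
open Summit.BirchSwinnertonDyer.BirchSwinnertonDyer.Theorems.SignedBaseChangeAcDivAdmdefBipartiteNVLevelOne

/-! ## Howard's merge induction: a unit `λ` anywhere ⟹ the core root, modulo the vanishing lemma -/

section Merge

variable {K : Type} [Field K] [NumberField K] {W : WeierstrassCurve ℚ} [W.IsElliptic] [W.IsGloballyMinimal] {p : ℕ} [Fact p.Prime]
  {κ : ZpExtension K p} {γ : absoluteGaloisGroup K} {N : ℕ} {ε : ℤˣ} {B : SignedBipartiteSystem W K p κ}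

/-- **Howard's rigidity at the root, `(c)`-direction, modulo the vanishing lemma.**  `B` a signed bipartite system of sign `ε` at level `N = N_E`
(`IsSignedBipartiteSystem`), `K` imaginary quadratic, `κ` anticyclotomic.  HYPOTHESES: (HV) for every `n ∈ 𝒩_1^def` with `λ_1(n)(0) ∈ ℤ_pˣ` the
bottom Selmer group `Sel^ε_n(K_0, E[p]) = signedOrdSelmerTorsion (E/K) p κ ε n 0 1` is zero (Howard's vanishing lemma — NOT proved here); (RK1) the
root group `Sel^ε_1(K_0, E[p])` is the line through a class `s ≠ 0`; (NV) `λ_1(n₀)(0) ∈ ℤ_pˣ` for some `n₀ ∈ 𝒩_1^def`.  CONCLUSION: `κ_1(1)_0 ≠ 0`.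
Proof: the merge induction of the module docstring (strong induction on the number of prime factors of `n₀`; descent `…AdmdefUnrLineNonzero`,
first law `…AdmdefUnitLambdaOfLoc`, root step `…AdmdefRootVisibleOfUnitLambda`, Selmer transfers of §2; no Čebotarev prime is used).
[cite: Howard2006, Thm. 3.2.3 (c), Lem. 2.3.3–2.3.4] [cite: BurungaleCastellaKim2021, arXiv:1908.09512 Lem. 7.3] [cite: CastellaEtAl2025, Thm. 7.5] -/
theorem kappa_one_layer_zero_ne_zero_of_isUnit_lam_of_vanishing (hB : IsSignedBipartiteSystem W K p κ γ N ε B)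
    (hN : (N : ℤ) = W.conductorNorm ℤ) (hK : IsImaginaryQuadratic K) (hκ : κ.IsAnticyclotomic)
    (hvan : ∀ n ∈ defProducts N K (fun ℓ ↦ W.frobeniusTrace ℓ) p 1, IsUnit (PowerSeries.constantCoeff (B.lam 1 n)) →
      ∀ c ∈ signedOrdSelmerTorsion (W.baseChange K) p κ ε n 0 1, c = 0)
    {s : (W.baseChange K).torsionH1Over ((p : ℤ) ^ 1) (κ.layerSubgroup 0)}
    (hs : s ∈ signedOrdSelmerTorsion (W.baseChange K) p κ ε 1 0 1) (hs0 : s ≠ 0)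
    (hline : ∀ c ∈ signedOrdSelmerTorsion (W.baseChange K) p κ ε 1 0 1, ∃ a : ℤ, c = a • s)
    {n₀ : ℕ} (hn₀ : n₀ ∈ defProducts N K (fun ℓ ↦ W.frobeniusTrace ℓ) p 1)
    (hlam : IsUnit (PowerSeries.constantCoeff (B.lam 1 n₀))) : B.kappa 1 1 0 ≠ 0 := by
  have hp : p.Prime := Fact.out
  have hN' : N = W.conductorNorm ℤ := by exact_mod_cast hN
  -- strong induction on the number of prime factors of the anchor vertex
  suffices h : ∀ (r : ℕ) {n : ℕ}, n.primeFactors.card = r → n ∈ defProducts N K (fun ℓ ↦ W.frobeniusTrace ℓ) p 1 →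
      IsUnit (PowerSeries.constantCoeff (B.lam 1 n)) → B.kappa 1 1 0 ≠ 0 from h _ rfl hn₀ hlam
  intro r
  induction r using Nat.strong_induction_on with
  | _ r ih =>
  intro n hr hn hlamn
  have hsqn : Squarefree n := hn.1.1
  -- (HV): `Sel_n = 0`, so `s ∉ Sel_n`: some prime `qᵢ ∣ n` is seen by `s`
  have hsn : s ∉ signedOrdSelmerTorsion (W.baseChange K) p κ ε n 0 1 := fun h ↦ hs0 (hvan n hn hlamn s h)
  have hseen : ¬ ∀ ℓ : ℕ, ℓ.Prime → ℓ ∣ n → ∀ v : HeightOneSpectrum (𝓞 K), ((p : ℕ) : 𝓞 K) ∉ v.asIdeal →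
      ((ℓ : ℕ) : 𝓞 K) ∈ v.asIdeal → ∀ 𝔓 ∈ v.primesAbove,
        s ∈ ordinaryAt (W.baseChange K) ((p : ℤ) ^ 1) (κ.layerSubgroup 0) 𝔓 :=
    fun h ↦ hsn (mem_signedOrdSelmerTorsion_of_dvd_of_forall_ordinaryAt (one_dvd n) hs fun ℓ hℓ hℓn _ ↦ h ℓ hℓ hℓn)
  push Not at hseen
  obtain ⟨qi, hqi, hqin, vi, hpvi, hqivi, 𝔓i, h𝔓i, hnotord⟩ := hseen
  rw [mem_ordinaryAt_iff] at hnotord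
  push Not at hnotord
  obtain ⟨φi, hφiH, hφiD, hφiF, hres⟩ := hnotord
  have hqiadm : IsAdmissiblePrime N K (fun ℓ ↦ W.frobeniusTrace ℓ) p 1 qi := hn.1.2 qi hqi hqin
  have hqiadmE : IsAdmissiblePrime (W.conductorNorm ℤ) K (fun ℓ ↦ W.frobeniusTrace ℓ) p 1 qi := hN' ▸ hqiadm
  have hφiker : φi ∈ κ.kerSubgroup :=
    decompositionSubgroup_le_kerSubgroup_of_isAdmissiblePrime (W := W) hK hκ hqiadmE hqivi h𝔓i hφiD
  by_cases hr1 : n.primeFactors.card = 1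
  · -- `r = 1`: `n = qᵢ` is adjacent to the root, and `s` itself is the witness at `φᵢ`
    have hnq : n = qi := eq_of_card_primeFactors_eq_one hsqn hr1 hqi hqin
    subst hnq
    exact kappa_one_layer_zero_ne_zero_of_isUnit_lam hB hqiadm hqivi h𝔓i hφiker hφiD hφiF _ hres hlamn
  · -- `r ≥ 3`: remove a prime `qⱼ ≠ qᵢ`
    have hcard_pos : 1 < n.primeFactors.card := by
      have h1 : 0 < n.primeFactors.card := Finset.card_pos.mpr ⟨qi, Nat.mem_primeFactors.mpr ⟨hqi, hqin, hsqn.ne_zero⟩⟩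
      omega
    obtain ⟨qj, hqjmem, hqjne⟩ := Finset.exists_mem_ne hcard_pos qi
    obtain ⟨hqj, hqjn, -⟩ := Nat.mem_primeFactors.mp hqjmem
    obtain ⟨hMq, hqjM, hsqM, hcardM⟩ := div_arith hsqn hqj hqjn
    set M := n / qj with hMdef
    have hMind : M ∈ indefProducts N K (fun ℓ ↦ W.frobeniusTrace ℓ) p 1 := div_mem_indefProducts_of_mem_defProducts hn hqj hqjn
    have hqjadm : IsAdmissiblePrime N K (fun ℓ ↦ W.frobeniusTrace ℓ) p 1 qj := hn.1.2 qj hqj hqjn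
    -- `qᵢ ∣ M`
    have hqiM : qi ∣ M := by
      have hcop : Nat.Coprime qi qj := (Nat.coprime_primes hqi hqj).mpr hqjne.symm
      exact hcop.dvd_of_dvd_mul_right (by rw [hMq]; exact hqin)
    -- the place of `K` over the inert `qⱼ`
    have hbotj : Ideal.span {((qj : ℕ) : 𝓞 K)} ≠ ⊥ := by
      rw [Ne, Ideal.span_singleton_eq_bot]; exact_mod_cast hqj.ne_zero
    obtain ⟨vj, hqjvj⟩ : ∃ v : HeightOneSpectrum (𝓞 K), ((qj : ℕ) : 𝓞 K) ∈ v.asIdeal :=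
      ⟨⟨Ideal.span {((qj : ℕ) : 𝓞 K)}, hqjadm.2.2.1, hbotj⟩, Ideal.mem_span_singleton_self _⟩
    -- DESCENT (witness-free): `κ_1(M)_0 ≠ 0`
    have hMqmem : M * qj ∈ defProducts N K (fun ℓ ↦ W.frobeniusTrace ℓ) p 1 := by rw [hMq]; exact hn
    have hκM : B.kappa 1 M 0 ≠ 0 :=
      kappa_layer_zero_ne_zero_of_isUnit_lam_mul_adicCompletionPrime hB hN hK hκ hMqmem hqjadm hqjM hqjvj (by rw [hMq]; exact hlamn)
    have hκMSel : B.kappa 1 M 0 ∈ signedOrdSelmerTorsion (W.baseChange K) p κ ε M 0 1 :=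
      kappa_layer_mem_signedOrdSelmerTorsion hB one_pos hMind 0
    by_cases hcase : ∀ q' : ℕ, q'.Prime → q' ∣ M → ∀ v : HeightOneSpectrum (𝓞 K), ((p : ℕ) : 𝓞 K) ∉ v.asIdeal →
        ((q' : ℕ) : 𝓞 K) ∈ v.asIdeal → ∀ 𝔓 ∈ v.primesAbove,
          B.kappa 1 M 0 ∈ unramifiedAt (W.baseChange K) ((p : ℤ) ^ 1) (κ.layerSubgroup 0) 𝔓
    · -- Case (B): `κ_1(M)_0` is unramified at every prime of `M`, hence in `Sel_1 = 𝔽_p s` — but it is ordinary at `qᵢ`, which `s` sees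
      exfalso
      have h1 : B.kappa 1 M 0 ∈ signedOrdSelmerTorsion (W.baseChange K) p κ ε 1 0 1 :=
        mem_signedOrdSelmerTorsion_of_dvd_of_forall_unramifiedAt (one_dvd M) hκMSel fun ℓ hℓ hℓM _ ↦ hcase ℓ hℓ hℓM
      obtain ⟨a, ha⟩ := hline _ h1
      have hord : resOfLe (geomTorsion (W.baseChange K) ((p : ℤ) ^ 1)) (Subgroup.zpowers_le.mpr hφiH) (B.kappa 1 M 0) = 0 :=
        (mem_ordinaryAt_iff _).mp
          (((mem_signedOrdSelmerTorsion_iff _).mp hκMSel).2.1 vi hpvi ⟨qi, hqi, hqiM, hqivi⟩ 𝔓i h𝔓i) φi hφiH hφiD hφiF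
      rw [ha, map_zsmul] at hord
      have hps : ((p : ℤ)) • s = 0 := by
        rw [natCast_zsmul]; exact nsmul_torsionH1Over_pow_one_eq_zero (W.baseChange K) p (κ.layerSubgroup 0) s
      have hpa : ¬ (p : ℤ) ∣ a := by
        rintro ⟨b, hb⟩
        apply hκM
        rw [ha, hb, mul_comm, mul_zsmul, hps, zsmul_zero]
      have hpu : ((p : ℤ)) • resOfLe (geomTorsion (W.baseChange K) ((p : ℤ) ^ 1)) (Subgroup.zpowers_le.mpr hφiH) s = 0 := by
        rw [← map_zsmul, hps, map_zero]
      exact hres (eq_zero_of_zsmul_eq_zero_of_not_dvd hp hpu hord hpa)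
    · -- Case (A): `κ_1(M)_0` is RAMIFIED at some prime `q' ∣ M`: the first law gives a unit at `M/q'`, with `r − 2` primes — induction
      push Not at hcase
      obtain ⟨q', hq', hq'M, v', hpv', hq'v', 𝔓', h𝔓', hnot⟩ := hcase
      obtain ⟨hM'q, hq'M', -, hcardM'⟩ := div_arith hsqM hq' hq'M
      set M' := M / q' with hM'def
      have hM'def' : M' ∈ defProducts N K (fun ℓ ↦ W.frobeniusTrace ℓ) p 1 := div_mem_defProducts_of_mem_indefProducts hMind hq' hq'M
      have hq'adm : IsAdmissiblePrime N K (fun ℓ ↦ W.frobeniusTrace ℓ) p 1 q' := hMind.1.2 q' hq' hq'M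
      have hne : ordLoc (W.baseChange K) p κ γ 1 𝔓' (B.kappa 1 (M' * q')) 0 0 ≠ 0 := by
        rw [hM'q, ordLoc_apply_zero]
        exact resOfLe_inertia_ne_zero_of_not_mem_unramifiedAt hpv' h𝔓' hnot
      have hlamM' : IsUnit (PowerSeries.constantCoeff (B.lam 1 M')) :=
        isUnit_constantCoeff_lam_of_ordLoc_ne_zero hB (by rw [hM'q]; exact hMind) hq'adm hq'M' hq'v' h𝔓' hne
      exact ih M'.primeFactors.card (by omega) rfl hM'def' hlamM'

/-- **The same for the limit base class** (`B.IsLimitBaseClass z`: `z_{0,1} = κ_1(1)_0`): under (HV), (RK1), (NV), `z_{0,1} ≠ 0`.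
[cite: CastellaEtAl2025, (7.2), Thm. 7.5] [cite: Howard2006, §3.2 (16), Thm. 3.2.3 (c)] -/
theorem limitBaseClass_layer_zero_one_ne_zero_of_isUnit_lam_of_vanishing (hB : IsSignedBipartiteSystem W K p κ γ N ε B)
    {z : Π n j : ℕ, (W.baseChange K).torsionH1Over ((p : ℤ) ^ j) (κ.layerSubgroup n)} (hz : B.IsLimitBaseClass z)
    (hN : (N : ℤ) = W.conductorNorm ℤ) (hK : IsImaginaryQuadratic K) (hκ : κ.IsAnticyclotomic)
    (hvan : ∀ n ∈ defProducts N K (fun ℓ ↦ W.frobeniusTrace ℓ) p 1, IsUnit (PowerSeries.constantCoeff (B.lam 1 n)) →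
      ∀ c ∈ signedOrdSelmerTorsion (W.baseChange K) p κ ε n 0 1, c = 0)
    {s : (W.baseChange K).torsionH1Over ((p : ℤ) ^ 1) (κ.layerSubgroup 0)}
    (hs : s ∈ signedOrdSelmerTorsion (W.baseChange K) p κ ε 1 0 1) (hs0 : s ≠ 0)
    (hline : ∀ c ∈ signedOrdSelmerTorsion (W.baseChange K) p κ ε 1 0 1, ∃ a : ℤ, c = a • s)
    {n₀ : ℕ} (hn₀ : n₀ ∈ defProducts N K (fun ℓ ↦ W.frobeniusTrace ℓ) p 1)
    (hlam : IsUnit (PowerSeries.constantCoeff (B.lam 1 n₀))) : z 0 1 ≠ 0 := by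
  rw [hz 0 1 one_pos]
  exact kappa_one_layer_zero_ne_zero_of_isUnit_lam_of_vanishing hB hN hK hκ hvan hs hs0 hline hn₀ hlam

/-- **Howard's criterion at the root, modulo the vanishing lemma: `B.HasUnitLambda N` ∧ (HV) ∧ (RK1) ⟹ `z_{0,1} ≠ 0`** — the mod-`𝔪` shadow of
CHKLL25 Thm. 7.5's «Moreover» (equality in the Heegner point main conjecture when some `λ_j(m) ≢ 0 mod 𝔪`) for the pinned system: a unit `λ` at
ANY definite vertex and ANY depth `j` (brought to `j = 1` by LEAD g16's `hasUnitLambda_iff_level_one`) forces the bottom base class of a rank-one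
bottom Selmer group to be non-zero. [cite: CastellaEtAl2025, Thm. 7.5 (arXiv:2308.10474v2 p0031 L13–L20)] [cite: Howard2006, Thm. 3.2.3 (c)]
[cite: BurungaleCastellaKim2021, arXiv:1908.09512 Prop. 7.4] -/
theorem limitBaseClass_layer_zero_one_ne_zero_of_hasUnitLambda_of_vanishing (hB : IsSignedBipartiteSystem W K p κ γ N ε B)
    {z : Π n j : ℕ, (W.baseChange K).torsionH1Over ((p : ℤ) ^ j) (κ.layerSubgroup n)} (hz : B.IsLimitBaseClass z)
    (hN : (N : ℤ) = W.conductorNorm ℤ) (hK : IsImaginaryQuadratic K) (hκ : κ.IsAnticyclotomic)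
    (hvan : ∀ n ∈ defProducts N K (fun ℓ ↦ W.frobeniusTrace ℓ) p 1, IsUnit (PowerSeries.constantCoeff (B.lam 1 n)) →
      ∀ c ∈ signedOrdSelmerTorsion (W.baseChange K) p κ ε n 0 1, c = 0)
    {s : (W.baseChange K).torsionH1Over ((p : ℤ) ^ 1) (κ.layerSubgroup 0)}
    (hs : s ∈ signedOrdSelmerTorsion (W.baseChange K) p κ ε 1 0 1) (hs0 : s ≠ 0)
    (hline : ∀ c ∈ signedOrdSelmerTorsion (W.baseChange K) p κ ε 1 0 1, ∃ a : ℤ, c = a • s)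
    (hNV : B.HasUnitLambda N) : z 0 1 ≠ 0 := by
  obtain ⟨m, hm, hunit⟩ := (hasUnitLambda_iff_level_one hB).mp hNV
  exact limitBaseClass_layer_zero_one_ne_zero_of_isUnit_lam_of_vanishing hB hz hN hK hκ hvan hs hs0 hline hm hunit

end Merge

end Summit.BirchSwinnertonDyer.BirchSwinnertonDyer.Theorems.SignedBaseChangeAcDivAdmdefHowardMerge

end
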